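import Literature.IUT.LogVolume.Theorem110TowerArith
import Literature.IUT.LogVolume.DifferentConductorTowerThreeField
import HarnessLib

/-!
# [IUTchIV] Theorem 1.10, Step (ii), for the GENUINE theta tower `F_tpd ⊆ F ⊆ K` of a point of the `λ`-line:
# the `K`-level different/conductor bound in the currency of `Cor22` (`P.logDiff`, `logCondAvoid`, `logCondOver`)

Mochizuki, *Inter-universal Teichmüller theory IV*, RIMS manuscript (Apr. 2020; = PRIMS **57** (2021)),
Theorem 1.10, proof Step (ii), p. 24, read DIRECTLY from `F_tpd` to `K` (see
`DifferentConductorTowerThreeField.lean`: the intermediate `F`-level display is not derivable when `E_F` is bad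
above `l`, the `K`-level chain is, with the printed constants):

> "log(𝔡^K) ≤ log(𝔡^K) + log(𝔣^K) ≤ log(𝔡^F) + log(𝔣^F) + 2·log(l) ≤ log(𝔡^{F_tpd}) + log(𝔣^{F_tpd}) + 2·log(l)
> + 21" [with `log(2^11·3^3·5^2) ≤ 21`].

BRIDGE file (over abc-iut-S3's `Theorem110TowerArith`: `logCondAvoid_eq_ndeg_reduced`,
`finBelow_mem_badPlacesAvoid_iff`): `ndeg_different_add_reduced_le_theta` (three abstract number fields, bad places
`S₀`, `hT`) is restated for the tower `P.F = F_tpd ⊆ F ⊆ K` over a point `P : NFPoint` (`λ = P.x`), the prime `l ≥ 7` and the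
set `S = {2, l}` of (P5), in the vocabulary of `Corollary22Legendre` / `Theorem110RealStepII` (abc-iut-S-d2/S3):
`log(𝔡^{F_tpd}) = P.logDiff`, `log(𝔣^{F_tpd}) = logCondAvoid P {2,l}` (bad places of `λ` = poles of `j(λ)` away
from `2l`, `badPlacesAvoid`), `log(𝔣^K) = logCondOver P {2,l} K` (the places of `K` over them, `badPlacesOver`),
`log(𝔡^K) = ndeg K (differentDivisor K)`; and with the ramification hypotheses in the shape abc-iut-S-d1 proves
them for the genuine theta tower ([IUTchIV] Prop. 1.8 (vi)(vii) / (D0); S5's division-field ramification):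

* `hKgood` — `K/F` unramified at the places of residue characteristic `≠ l` NOT over `Cor22.badPlaces P`
  (good reduction of `E_F`; Néron–Ogg–Shafarevich, `l` invertible);
* `hKbad` — `K/F` tame (`p ∤ e`) at the places of residue characteristic `≠ l` over `badPlaces P` (bad
  multiplicative reduction: `e ∣ l`);
* `hFgood` — `F/F_tpd` unramified at the places of residue characteristic `∉ {2,3,5}` not over `badPlaces P`
  (the Legendre model has good reduction there; `E[15]`, `√−1` unramified);
* `hFtame` — `F/F_tpd` tame away from `{2,3,5}` (`e ∣ [F:F_tpd] ∣ 2^{10}·3^2·5`);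
* `hdegF : [F:F_tpd] ∣ 2^{10}·3^2·5` (`IsThetaField`: `∣ 46080`), `hdegK : [K:F] ∣ l·(l−1)²·(l+1)`, both layers
  Galois.

Main result: **`Cor22.ndeg_differentDivisor_add_logCondOver_le`**:
`ndeg K (differentDivisor K) + logCondOver P {2,l} K ≤ P.logDiff + logCondAvoid P {2,l} + (log(2^11·3^3·5^2) +
2·log l)` — i.e. with `X.logDiffF := X.logDiffTpd + log(2^11·3^3·5^2)`, `X.logCondF := X.logCondTpd` (free in
`Cor22.Matches`) the fields `F_le`, `K_le` of `Thm110Numerics.ProofData` hold for `logDiffK := ndeg K 𝔡^K`,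
`logCondK := logCondOver P {2,l} K` (`proofData_stepii_fields`). Classical algebraic number theory; nothing here
takes a side on [IUTchIII] Cor. 3.12 (the disputed input of Thm. 1.10 is elsewhere).
-/

noncomputable section

namespace Literature.IUT.LogVolume

namespace Cor22

open NumberField IsDedekindDomain Real Finset Ideal Module
open Literature.NumberTheory.DiophantineGeometry.GenEll
open Literature.NumberTheory.NumberFields (natCast_mem_iff_absNorm_under_dvd)

/-! ## Residue characteristics and the `{2,l}`-avoiding bad places -/

/-- `(p) ⊆ 𝔭_v ⟺ p = p_v` for a prime `p` and a finite place `v`. [cite: NeukirchANT1999, Ch. I (8.2)] -/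
theorem natCast_mem_asIdeal_iff_residueChar_eq {F : Type*} [Field F] [NumberField F]
    (v : HeightOneSpectrum (𝓞 F)) {p : ℕ} (hp : p.Prime) :
    ((p : ℕ) : 𝓞 F) ∈ v.asIdeal ↔ residueChar F v = p := by
  rw [natCast_mem_iff_absNorm_under_dvd F v.asIdeal p]
  change residueChar F v ∣ p ↔ residueChar F v = p
  exact ⟨fun h => (Nat.prime_dvd_prime_iff_eq (residueChar_prime F v) hp).mp h, fun h => h ▸ dvd_rfl⟩

open scoped Classical in
/-- A bad place whose residue characteristic avoids the primes of `S` is a bad place "away from `S`".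
[claim: Mochizuki2012, status: disputed] -/
theorem mem_badPlacesAvoid_of_residueChar_notMem {P : NFPoint} {S : Finset ℕ} (hS : ∀ p ∈ S, p.Prime)
    {v : HeightOneSpectrum (𝓞 P.F)} (hv : v ∈ badPlaces P) (hres : residueChar P.F v ∉ S) :
    v ∈ badPlacesAvoid P S := by
  unfold badPlacesAvoid
  refine Finset.mem_filter.mpr ⟨hv, fun p hp hmem => hres ?_⟩
  rwa [← (natCast_mem_asIdeal_iff_residueChar_eq v (hS p hp)).mp hmem] at hp

open scoped Classical in
/-- `badPlacesAvoid P S ⊆ badPlaces P`. [claim: Mochizuki2012, status: disputed] -/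
theorem badPlacesAvoid_subset (P : NFPoint) (S : Finset ℕ) : badPlacesAvoid P S ⊆ badPlaces P := by
  unfold badPlacesAvoid; exact Finset.filter_subset _ _

/-! ## The `Cor22` quantities as normalized degrees of arithmetic divisors -/

/-- `log(𝔣^K) = deg(Σ_{w ∈ 𝕍(K)^bad} w)`: `logCondOver P S K = ndeg K (ADivisor.reduced (badPlacesOver P S K))`.
[claim: Mochizuki2012, status: disputed] -/
theorem logCondOver_eq_ndeg_reduced (P : NFPoint) (S : Finset ℕ) (K : Type) [Field K] [NumberField K]
    [Algebra P.F K] : logCondOver P S K = ndeg K (ADivisor.reduced (badPlacesOver P S K)) := by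
  unfold logCondOver
  rw [ndeg_apply, ADivisor.degF_reduced_eq_sum, div_eq_inv_mul]
  rfl

/-! ## The `K`-level Step (ii) bound for the genuine tower -/

/-- **[IUTchIV] Thm. 1.10, Step (ii), for the genuine tower `F_tpd ⊆ F ⊆ K` of a point of the `λ`-line, with
the printed constants**: `log(𝔡^K) + log(𝔣^K) ≤ log(𝔡^{F_tpd}) + log(𝔣^{F_tpd}) + log(2^11·3^3·5^2) + 2·log(l)`,
i.e. `ndeg K (differentDivisor K) + logCondOver P {2,l} K ≤ P.logDiff + logCondAvoid P {2,l} + …` — for any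
number fields `F ⊇ P.F`, `K ⊇ F` with `F/F_tpd` Galois of degree `∣ 2^{10}·3^2·5`, `K/F` Galois of degree
`∣ l·(l−1)²·(l+1)`, `l ≥ 7` prime, and the (D0)-type ramification facts `hKgood`, `hKbad`, `hFgood`, `hFtame`
(Prop. 1.8 (vi)(vii)). The two printed displays of p. 24 composed and read directly `F_tpd → K`, so that bad
reduction of `E_F` above `2l` — permitted by the statement of Thm. 1.10 and by `Thm110Legendre` — is covered.
[claim: Mochizuki2012, status: disputed] -/
theorem ndeg_differentDivisor_add_logCondOver_le (P : NFPoint) {l : ℕ} (hl : l.Prime) (h7 : 7 ≤ l)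
    (F K : Type) [Field F] [NumberField F] [Algebra P.F F] [Field K] [NumberField K] [Algebra F K]
    [Algebra P.F K] [IsScalarTower P.F F K] [IsGalois P.F F] [IsGalois F K]
    (hdegF : finrank P.F F ∣ 2 ^ 10 * 3 ^ 2 * 5) (hdegK : finrank F K ∣ l * (l - 1) ^ 2 * (l + 1))
    (hKgood : ∀ u : HeightOneSpectrum (𝓞 K), residueChar K u ≠ l → finBelow P.F K u ∉ badPlaces P →
      u.asIdeal.ramificationIdx (𝓞 F) = 1)
    (hKbad : ∀ u : HeightOneSpectrum (𝓞 K), residueChar K u ≠ l → finBelow P.F K u ∈ badPlaces P →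
      ¬ residueChar K u ∣ u.asIdeal.ramificationIdx (𝓞 F))
    (hFgood : ∀ w : HeightOneSpectrum (𝓞 F), residueChar F w ∉ ({2, 3, 5} : Finset ℕ) →
      finBelow P.F F w ∉ badPlaces P → w.asIdeal.ramificationIdx (𝓞 P.F) = 1)
    (hFtame : ∀ w : HeightOneSpectrum (𝓞 F), residueChar F w ∉ ({2, 3, 5} : Finset ℕ) →
      ¬ residueChar F w ∣ w.asIdeal.ramificationIdx (𝓞 P.F)) :
    ndeg K (differentDivisor K) + logCondOver P {2, l} K ≤
      P.logDiff + logCondAvoid P {2, l} + (Real.log (2 ^ 11 * 3 ^ 3 * 5 ^ 2) + 2 * Real.log l) := by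
  classical
  have hS : ∀ p ∈ ({2, l} : Finset ℕ), p.Prime := by
    intro p hp
    simp only [Finset.mem_insert, Finset.mem_singleton] at hp
    rcases hp with rfl | rfl
    · exact Nat.prime_two
    · exact hl
  set S₀ := badPlacesAvoid P {2, l} with hS₀
  set T := badPlacesOver P {2, l} K with hTdef
  have hT : ∀ u, u ∈ T ↔ finBelow P.F K u ∈ S₀ := fun u => finBelow_mem_badPlacesAvoid_iff P {2, l} K u
  -- a place of residue characteristic `∉ {2, l}` is over `S₀` iff it is over `badPlaces P`
  have hres_K : ∀ u : HeightOneSpectrum (𝓞 K), residueChar P.F (finBelow P.F K u) = residueChar K u :=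
    fun u => residueChar_finBelow (F := P.F) u
  have hres_F : ∀ w : HeightOneSpectrum (𝓞 F), residueChar P.F (finBelow P.F F w) = residueChar F w :=
    fun w => residueChar_finBelow (F := P.F) w
  have avoid_of_bad : ∀ v : HeightOneSpectrum (𝓞 P.F), v ∈ badPlaces P → residueChar P.F v ≠ 2 →
      residueChar P.F v ≠ l → v ∈ S₀ := by
    intro v hv h2 hl'
    refine mem_badPlacesAvoid_of_residueChar_notMem hS hv ?_
    simp only [Finset.mem_insert, Finset.mem_singleton, not_or]
    exact ⟨h2, hl'⟩
  rw [logCondOver_eq_ndeg_reduced, logCondAvoid_eq_ndeg_reduced, logDiff_eq_ndeg_differentDivisor]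
  refine ndeg_different_add_reduced_le_theta P.F F K hl h7 S₀ T hT hdegF hdegK ?_ ?_ ?_ ?_ hFtame
  · -- hKunr
    intro u hp hSu
    simp only [Finset.mem_insert, Finset.mem_singleton, not_or] at hp
    refine hKgood u hp.2.2.2 fun hb => hSu ?_
    exact avoid_of_bad _ hb (by rw [hres_K]; exact hp.1) (by rw [hres_K]; exact hp.2.2.2)
  · -- hKtame
    intro u hp hSu
    simp only [Finset.mem_insert, Finset.mem_singleton, not_or] at hp
    exact hKbad u hp.2.2.2 (badPlacesAvoid_subset P {2, l} hSu)
  · -- hKtop: above `2·3·5` the layer `K/F` is tame (good ⇒ unramified, bad ⇒ `e ∣ l`)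
    intro u hp
    have hne : residueChar K u ≠ l := by
      simp only [Finset.mem_insert, Finset.mem_singleton] at hp
      rcases hp with h | h | h <;> omega
    by_cases hb : finBelow P.F K u ∈ badPlaces P
    · exact hKbad u hne hb
    · rw [hKgood u hne hb, Nat.dvd_one]
      exact (residueChar_prime K u).ne_one
  · -- hFunr
    intro w hp hSw
    simp only [Finset.mem_insert, Finset.mem_singleton, not_or] at hp
    refine hFgood w (by simp only [Finset.mem_insert, Finset.mem_singleton, not_or]; exact ⟨hp.1, hp.2.1, hp.2.2.1⟩)
      fun hb => hSw ?_
    exact avoid_of_bad _ hb (by rw [hres_F]; exact hp.1) (by rw [hres_F]; exact hp.2.2.2)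

/-- **The Step (ii) fields of `Thm110Numerics.ProofData` for the genuine tower.** With the identifications of
`Cor22.Matches` (`X.logDiffTpd = P.logDiff`, `X.logCondTpd = logCondAvoid P {2,l}`) and the free `F`-level fields
set to `logDiffF := P.logDiff + log(2^11·3^3·5^2)`, `logCondF := logCondAvoid P {2,l}`, the three displays
`tpd_le_F`, `F_le`, `K_le` hold for `logDiffK := ndeg K (differentDivisor K)`, `logCondK := logCondOver P {2,l} K`
— a direct reading of `ndeg_differentDivisor_add_logCondOver_le`; the `F`-level numbers are NOT claimed to be
`log(𝔡^F)`, `log(𝔣^F)` (finding F-Sd1g3-1: the printed `F`-level display can fail when `E_F` is bad above `l`).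
[claim: Mochizuki2012, status: disputed] -/
theorem proofData_stepii_fields (P : NFPoint) {l : ℕ} (hl : l.Prime) (h7 : 7 ≤ l)
    (F K : Type) [Field F] [NumberField F] [Algebra P.F F] [Field K] [NumberField K] [Algebra F K]
    [Algebra P.F K] [IsScalarTower P.F F K] [IsGalois P.F F] [IsGalois F K]
    (hdegF : finrank P.F F ∣ 2 ^ 10 * 3 ^ 2 * 5) (hdegK : finrank F K ∣ l * (l - 1) ^ 2 * (l + 1))
    (hKgood : ∀ u : HeightOneSpectrum (𝓞 K), residueChar K u ≠ l → finBelow P.F K u ∉ badPlaces P →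
      u.asIdeal.ramificationIdx (𝓞 F) = 1)
    (hKbad : ∀ u : HeightOneSpectrum (𝓞 K), residueChar K u ≠ l → finBelow P.F K u ∈ badPlaces P →
      ¬ residueChar K u ∣ u.asIdeal.ramificationIdx (𝓞 F))
    (hFgood : ∀ w : HeightOneSpectrum (𝓞 F), residueChar F w ∉ ({2, 3, 5} : Finset ℕ) →
      finBelow P.F F w ∉ badPlaces P → w.asIdeal.ramificationIdx (𝓞 P.F) = 1)
    (hFtame : ∀ w : HeightOneSpectrum (𝓞 F), residueChar F w ∉ ({2, 3, 5} : Finset ℕ) →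
      ¬ residueChar F w ∣ w.asIdeal.ramificationIdx (𝓞 P.F)) :
    -- `tpd_le_F`
    (P.logDiff + logCondAvoid P {2, l} ≤
        (P.logDiff + Real.log (2 ^ 11 * 3 ^ 3 * 5 ^ 2)) + logCondAvoid P {2, l}) ∧
    -- `F_le`
    ((P.logDiff + Real.log (2 ^ 11 * 3 ^ 3 * 5 ^ 2)) + logCondAvoid P {2, l} ≤
        P.logDiff + logCondAvoid P {2, l} + Real.log (2 ^ 11 * 3 ^ 3 * 5 ^ 2)) ∧
    -- `K_le`
    (ndeg K (differentDivisor K) + logCondOver P {2, l} K ≤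
        (P.logDiff + Real.log (2 ^ 11 * 3 ^ 3 * 5 ^ 2)) + logCondAvoid P {2, l} + 2 * Real.log (l : ℕ)) := by
  have h := ndeg_differentDivisor_add_logCondOver_le P hl h7 F K hdegF hdegK hKgood hKbad hFgood hFtame
  have hlog : 0 ≤ Real.log (2 ^ 11 * 3 ^ 3 * 5 ^ 2 : ℝ) := Real.log_nonneg (by norm_num)
  refine ⟨by linarith, by linarith, by linarith⟩

/-- **The `K`-level Step (ii) bound with a PARAMETRIC 2-power in `[F : F_tpd]`** (`[F:F_tpd] ∣ 2^a·3^2·5`,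
constant `log(2^{a+1}·3^3·5^2) + 2·log(l)`): `a = 10` for print's `F_E = F_tpd(√−1, E_λ[15])`, `a = 12` for the
cell's reading v3 `F‡ = F_tpd(√−1, √λ, √(λ−1), E_λ[15])` (abc-iut-plan 2026-08-26T02:33:05Z). Since
`log(2^{13}·3^3·5^2) ≤ 21`, Step (ii)'s printed "`+ 21`" line, Step (iii)'s "`2·log(l) + 52`" and the route
constant `B_III` are unaffected by the choice. [claim: Mochizuki2012, status: disputed] -/
theorem ndeg_differentDivisor_add_logCondOver_le_pow (P : NFPoint) {l : ℕ} (hl : l.Prime) (h7 : 7 ≤ l) (a : ℕ)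
    (F K : Type) [Field F] [NumberField F] [Algebra P.F F] [Field K] [NumberField K] [Algebra F K]
    [Algebra P.F K] [IsScalarTower P.F F K] [IsGalois P.F F] [IsGalois F K]
    (hdegF : finrank P.F F ∣ 2 ^ a * 3 ^ 2 * 5) (hdegK : finrank F K ∣ l * (l - 1) ^ 2 * (l + 1))
    (hKgood : ∀ u : HeightOneSpectrum (𝓞 K), residueChar K u ≠ l → finBelow P.F K u ∉ badPlaces P →
      u.asIdeal.ramificationIdx (𝓞 F) = 1)
    (hKbad : ∀ u : HeightOneSpectrum (𝓞 K), residueChar K u ≠ l → finBelow P.F K u ∈ badPlaces P →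
      ¬ residueChar K u ∣ u.asIdeal.ramificationIdx (𝓞 F))
    (hFgood : ∀ w : HeightOneSpectrum (𝓞 F), residueChar F w ∉ ({2, 3, 5} : Finset ℕ) →
      finBelow P.F F w ∉ badPlaces P → w.asIdeal.ramificationIdx (𝓞 P.F) = 1)
    (hFtame : ∀ w : HeightOneSpectrum (𝓞 F), residueChar F w ∉ ({2, 3, 5} : Finset ℕ) →
      ¬ residueChar F w ∣ w.asIdeal.ramificationIdx (𝓞 P.F)) :
    ndeg K (differentDivisor K) + logCondOver P {2, l} K ≤
      P.logDiff + logCondAvoid P {2, l} + (Real.log (2 ^ (a + 1) * 3 ^ 3 * 5 ^ 2) + 2 * Real.log l) := by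
  classical
  have hS : ∀ p ∈ ({2, l} : Finset ℕ), p.Prime := by
    intro p hp
    simp only [Finset.mem_insert, Finset.mem_singleton] at hp
    rcases hp with rfl | rfl
    · exact Nat.prime_two
    · exact hl
  set S₀ := badPlacesAvoid P {2, l} with hS₀
  set T := badPlacesOver P {2, l} K with hTdef
  have hT : ∀ u, u ∈ T ↔ finBelow P.F K u ∈ S₀ := fun u => finBelow_mem_badPlacesAvoid_iff P {2, l} K u
  have hres_K : ∀ u : HeightOneSpectrum (𝓞 K), residueChar P.F (finBelow P.F K u) = residueChar K u :=
    fun u => residueChar_finBelow (F := P.F) u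
  have hres_F : ∀ w : HeightOneSpectrum (𝓞 F), residueChar P.F (finBelow P.F F w) = residueChar F w :=
    fun w => residueChar_finBelow (F := P.F) w
  have avoid_of_bad : ∀ v : HeightOneSpectrum (𝓞 P.F), v ∈ badPlaces P → residueChar P.F v ≠ 2 →
      residueChar P.F v ≠ l → v ∈ S₀ := by
    intro v hv h2 hl'
    refine mem_badPlacesAvoid_of_residueChar_notMem hS hv ?_
    simp only [Finset.mem_insert, Finset.mem_singleton, not_or]
    exact ⟨h2, hl'⟩
  rw [logCondOver_eq_ndeg_reduced, logCondAvoid_eq_ndeg_reduced, logDiff_eq_ndeg_differentDivisor]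
  refine ndeg_different_add_reduced_le_theta_pow P.F F K hl h7 a S₀ T hT hdegF hdegK ?_ ?_ ?_ ?_ hFtame
  · intro u hp hSu
    simp only [Finset.mem_insert, Finset.mem_singleton, not_or] at hp
    refine hKgood u hp.2.2.2 fun hb => hSu ?_
    exact avoid_of_bad _ hb (by rw [hres_K]; exact hp.1) (by rw [hres_K]; exact hp.2.2.2)
  · intro u hp hSu
    simp only [Finset.mem_insert, Finset.mem_singleton, not_or] at hp
    exact hKbad u hp.2.2.2 (badPlacesAvoid_subset P {2, l} hSu)
  · intro u hp
    have hne : residueChar K u ≠ l := by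
      simp only [Finset.mem_insert, Finset.mem_singleton] at hp
      rcases hp with h | h | h <;> omega
    by_cases hb : finBelow P.F K u ∈ badPlaces P
    · exact hKbad u hne hb
    · rw [hKgood u hne hb, Nat.dvd_one]
      exact (residueChar_prime K u).ne_one
  · intro w hp hSw
    simp only [Finset.mem_insert, Finset.mem_singleton, not_or] at hp
    refine hFgood w (by simp only [Finset.mem_insert, Finset.mem_singleton, not_or]; exact ⟨hp.1, hp.2.1, hp.2.2.1⟩)
      fun hb => hSw ?_
    exact avoid_of_bad _ hb (by rw [hres_F]; exact hp.1) (by rw [hres_F]; exact hp.2.2.2)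

end Cor22

end Literature.IUT.LogVolume

end
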